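import Literature.MathematicalPhysics.QuantumLattice.AndersonXYStarBound
import HarnessLib

/-!
# Anderson's cluster lower bound for the spin-½ ferromagnetic XY model on the torus

Trunk T-QLATTICE; corollary file of `AndersonXYStarBound.lean`. For the hard-core-boson /
ferromagnetic XY Hamiltonian `xyTorus d L 1 = -Σ_{⟨xy⟩}(Sˣ_xSˣ_y + Sʸ_xSʸ_y)` on `(ℤ/Lℤ)^d`,
`L ≥ 3`, every bond lies in the stars of its two endpoints, so `H = -½ Σ_x T_x` with the `2d`-leaf
star operators `T_x`; superadditivity of the ground energy and the star bound
`E₀(-T_x) ≥ -(2d+1)/4` give **`E₀(xyTorus d L 1) ≥ -((2d+1)/8)·L^d`**, i.e. `≥ -(2d+1)/(8d)`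
per bond (`-5/16` in `d = 2`), uniformly in `L` — P. W. Anderson's method (Phys. Rev. 83 (1951)
1260) for the XY model. Equivalently: the nearest-neighbour transverse correlation of ANY state
obeys `⟨S⁺_xS⁻_y + S⁻_xS⁺_y⟩/2 ≤ (2d+1)/(8d)` on average over bonds. No definition is introduced.

## References

* [Anderson1951] P. W. Anderson, Phys. Rev. 83 (1951) 1260.
-/

noncomputable section

open Matrix Complex Finset
open scoped ComplexOrder

namespace Literature.MathematicalPhysics.QuantumLattice

/-! ### Anderson's bound for the ferromagnetic XY torus (hard-core bosons) -/

section XYTorus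

open Literature.Probability.LatticeModels

variable {d : ℕ} (L : ℕ) [NeZero L]

omit [NeZero L] in
/-- The `2d` neighbours `x ± eᵢ` of a site of the torus of side `L ≥ 3` are pairwise distinct.
[folklore] -/
theorem torusNbr_injective (hL : 3 ≤ L) (x : TorusSite d L) :
    Function.Injective (fun p : Fin d × Bool =>
      if p.2 then x + Pi.single p.1 (1 : ZMod L) else x - Pi.single p.1 1) := by
  haveI : Fact (1 < L) := ⟨by omega⟩
  have h2 : (2 : ZMod L) ≠ 0 := by
    intro h
    have h' : ((2 : ℕ) : ZMod L) = 0 := by exact_mod_cast h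
    rw [ZMod.natCast_eq_zero_iff] at h'
    exact absurd (Nat.le_of_dvd (by norm_num) h') (by omega)
  have hsingle : ∀ i j : Fin d, (Pi.single i (1 : ZMod L) : TorusSite d L) = Pi.single j 1 → i = j := by
    intro i j h
    by_contra hij
    have := congrFun h i
    rw [Pi.single_eq_same, Pi.single_eq_of_ne hij] at this
    exact one_ne_zero this
  have hplusminus : ∀ i j : Fin d,
      (Pi.single i (1 : ZMod L) : TorusSite d L) + Pi.single j 1 ≠ 0 := by
    intro i j h
    by_cases hij : i = j
    · subst hij
      have := congrFun h i
      rw [Pi.add_apply, Pi.single_eq_same, Pi.zero_apply, ← two_mul, mul_one] at this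
      exact h2 this
    · have := congrFun h i
      rw [Pi.add_apply, Pi.single_eq_same, Pi.single_eq_of_ne hij, add_zero, Pi.zero_apply] at this
      exact one_ne_zero this
  rintro ⟨i, b⟩ ⟨j, c⟩ h
  cases b <;> cases c <;> simp only [Bool.false_eq_true, ↓reduceIte] at h
  · -- `x - eᵢ = x - eⱼ`
    have : (Pi.single i (1 : ZMod L) : TorusSite d L) = Pi.single j 1 := by
      have := congrArg (fun y => x - y) h; simpa using this
    rw [hsingle i j this]
  · -- `x - eᵢ = x + eⱼ`
    exfalso
    apply hplusminus j i
    have := congrArg (fun y => y - x) h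
    simp only [sub_sub_cancel_left, add_sub_cancel_left] at this
    rw [← this]; abel
  · -- `x + eᵢ = x - eⱼ`
    exfalso
    apply hplusminus i j
    have := congrArg (fun y => y - x) h
    simp only [sub_sub_cancel_left, add_sub_cancel_left] at this
    rw [this]; abel
  · have : (Pi.single i (1 : ZMod L) : TorusSite d L) = Pi.single j 1 := add_left_cancel h
    rw [hsingle i j this]

/-- **Anderson's lower bound for the spin-½ ferromagnetic XY model on the torus `(ℤ/Lℤ)^d`**
(`L ≥ 3`, any `d`): `E₀(H) ≥ -((2d+1)/8)·L^d`, i.e. at least `-(2d+1)/(8d)` per bond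
(`-5/16` in `d = 2`; the sharp star value is `-√(2d(2d+2))/(8d)`, `-√6/8` in `d = 2`).
Proof: `H = -Σ_{⟨xy⟩}(SˣSˣ + SʸSʸ) = -½ Σ_x T_x` with the star operators `T_x` (every bond lies in
the stars of its two endpoints), `E₀(Σ) ≥ Σ E₀` and the star bound `E₀(-T_x) ≥ -(2d+1)/4`.
[cite: Anderson1951] -/
theorem xyTorus_one_groundEnergy_ge (hL : 3 ≤ L) :
    -(((2 * d + 1 : ℝ) / 8) * (L : ℝ) ^ d) ≤ (xyTorus d L 1).groundEnergy := by
  haveI : Nonempty (TensorIndex (TorusSite d L) 2) := ⟨fun _ => 0⟩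
  have hL2 : 2 ≤ L := by omega
  -- bond operators and stars
  set f : TorusSite d L → TorusSite d L → Op (TorusSite d L) 2 := fun x y =>
    siteSpin 1 x 0 * siteSpin 1 y 0 + siteSpin 1 x 1 * siteSpin 1 y 1 with hf
  have hfsymm : ∀ {x y : TorusSite d L}, x ≠ y → f x y = f y x := by
    intro x y hxy
    simp only [hf, (siteSpin_commute_of_ne_holds 1 hxy 0 0).eq, (siteSpin_commute_of_ne_holds 1 hxy 1 1).eq]
  set nbr : TorusSite d L → Fin d × Bool → TorusSite d L := fun x p =>
    if p.2 then x + Pi.single p.1 (1 : ZMod L) else x - Pi.single p.1 1 with hnbr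
  set Y : TorusSite d L → Finset (TorusSite d L) := fun x => Finset.univ.image (nbr x) with hY
  set T : TorusSite d L → Op (TorusSite d L) 2 := fun x => ∑ y ∈ Y x, f x y with hT
  have hne : ∀ (x : TorusSite d L) (i : Fin d), x ≠ x + Pi.single i 1 := by
    intro x i h
    exact single_ne_zero_of_two_le L hL2 i (by simpa using h.symm)
  have hne' : ∀ (x : TorusSite d L) (i : Fin d), x ≠ x - Pi.single i 1 := by
    intro x i h
    exact single_ne_zero_of_two_le L hL2 i (by simpa [sub_eq_add_neg] using h.symm)
  have hxY : ∀ x, x ∉ Y x := by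
    intro x hx
    rw [hY, Finset.mem_image] at hx
    obtain ⟨⟨i, b⟩, -, hb⟩ := hx
    cases b
    · exact hne' x i (by simpa [hnbr] using hb.symm)
    · exact hne x i (by simpa [hnbr] using hb.symm)
  have hcard : ∀ x, (Y x).card = 2 * d := by
    intro x
    rw [hY, Finset.card_image_of_injective _ (torusNbr_injective L hL x), Finset.card_univ,
      Fintype.card_prod, Fintype.card_fin, Fintype.card_bool, mul_comm]
  -- `T_x = Σᵢ (f(x, x+eᵢ) + f(x, x-eᵢ))`
  have hTsum : ∀ x, T x = ∑ i : Fin d, (f x (x + Pi.single i 1) + f x (x - Pi.single i 1)) := by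
    intro x
    rw [hT]
    dsimp only
    rw [hY, Finset.sum_image fun p _ q _ h => torusNbr_injective L hL x h, Fintype.sum_prod_type]
    refine Finset.sum_congr rfl fun i _ => ?_
    rw [Fintype.sum_bool]
    rfl
  -- `H = -Σ_x Σᵢ f(x, x+eᵢ)`
  have hH : xyTorus d L 1 = -∑ x : TorusSite d L, ∑ i : Fin d, f x (x + Pi.single i 1) := by
    rw [xyTorus_eq_bondSum, ← sum_pairs_eq_sum_edgeFinset' L hL, ← Finset.sum_neg_distrib]
    refine Finset.sum_congr rfl fun x _ => ?_
    rw [← Finset.sum_neg_distrib]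
    refine Finset.sum_congr rfl fun i _ => ?_
    rw [Sym2.lift_mk]
    dsimp only
    rw [spinBond_eq_mul_of_ne (hne x i) 0, spinBond_eq_mul_of_ne (hne x i) 1]
    simp only [hf, Complex.ofReal_neg, Complex.ofReal_one, neg_smul, one_smul, Complex.ofReal_zero,
      zero_smul, add_zero, neg_add]
  -- `Σ_x f(x, x-eᵢ) = Σ_x f(x, x+eᵢ)`
  have hshift : ∀ i : Fin d, ∑ x : TorusSite d L, f x (x - Pi.single i 1) =
      ∑ x : TorusSite d L, f x (x + Pi.single i 1) := by
    intro i
    rw [← Equiv.sum_comp (Equiv.addRight (Pi.single i (1 : ZMod L)))]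
    refine Finset.sum_congr rfl fun x _ => ?_
    simp only [Equiv.coe_addRight, add_sub_cancel_right]
    exact hfsymm (hne x i).symm
  have hminus : (∑ x : TorusSite d L, ∑ i : Fin d, f x (x - Pi.single i 1)) =
      ∑ x : TorusSite d L, ∑ i : Fin d, f x (x + Pi.single i 1) := by
    rw [Finset.sum_comm, Finset.sum_congr rfl fun i _ => hshift i, Finset.sum_comm]
  have h2 : (2 : ℂ) • xyTorus d L 1 = -∑ x : TorusSite d L, T x := by
    rw [two_smul]
    conv_lhs => rw [hH]
    rw [← neg_add, ← Finset.sum_add_distrib, Finset.sum_congr rfl fun x _ => (hTsum x)]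
    congr 1
    simp only [Finset.sum_add_distrib]
    rw [hminus]
  have hH' : xyTorus d L 1 = ∑ x : TorusSite d L, (((1 / 2 : ℝ) : ℂ) • (-T x)) := by
    calc xyTorus d L 1 = (1 / 2 : ℂ) • ((2 : ℂ) • xyTorus d L 1) := by
          rw [smul_smul]; norm_num
      _ = (1 / 2 : ℂ) • (-∑ x : TorusSite d L, T x) := by rw [h2]
      _ = ∑ x : TorusSite d L, (((1 / 2 : ℝ) : ℂ) • (-T x)) := by
          rw [← Finset.sum_neg_distrib, Finset.smul_sum]
          push_cast
          rfl
  -- Hermiticity of the stars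
  have hTh : ∀ x, (-T x).IsHermitian := by
    intro x
    refine Matrix.IsHermitian.neg ?_
    rw [hT]
    dsimp only
    rw [IsHermitian, conjTranspose_sum]
    refine Finset.sum_congr rfl fun y hy => ?_
    have hxy : x ≠ y := (ne_of_mem_of_not_mem hy (hxY x)).symm
    simp only [hf, conjTranspose_add, conjTranspose_mul, (siteSpin_isHermitian 1 x 0).eq,
      (siteSpin_isHermitian 1 y 0).eq, (siteSpin_isHermitian 1 x 1).eq, (siteSpin_isHermitian 1 y 1).eq,
      (siteSpin_commute_of_ne_holds 1 hxy 0 0).eq, (siteSpin_commute_of_ne_holds 1 hxy 1 1).eq]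
  -- assemble
  rw [hH']
  refine le_trans ?_ (Matrix.groundEnergy_sum_ge _ fun x _ => (hTh x).ofReal_smul _)
  have hstar : ∀ x : TorusSite d L, -((2 * d + 1 : ℝ) / 8) ≤
      ((((1 / 2 : ℝ) : ℂ) • (-T x)).groundEnergy) := by
    intro x
    rw [Matrix.groundEnergy_smul_of_pos (hTh x) (by norm_num : (0 : ℝ) < 1 / 2)]
    have h := neg_xyStar_groundEnergy_ge (Λ := TorusSite d L) (hxY x)
    rw [hcard x] at h
    push_cast at h
    have : -((2 * d + 1 : ℝ) / 8) = 1 / 2 * (-((2 * (d : ℝ) + 1) / 4)) := by ring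
    rw [this]
    exact mul_le_mul_of_nonneg_left h (by norm_num)
  calc -(((2 * d + 1 : ℝ) / 8) * (L : ℝ) ^ d)
      = ∑ _x : TorusSite d L, -((2 * d + 1 : ℝ) / 8) := by
        rw [Finset.sum_const, Finset.card_univ, nsmul_eq_mul]
        have : (Fintype.card (TorusSite d L) : ℝ) = (L : ℝ) ^ d := by
          rw [show Fintype.card (TorusSite d L) = L ^ d by
            rw [Fintype.card_fun, ZMod.card, Fintype.card_fin]]
          push_cast; ring
        rw [this]; ring
    _ ≤ ∑ x : TorusSite d L, ((((1 / 2 : ℝ) : ℂ) • (-T x)).groundEnergy) :=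
        Finset.sum_le_sum fun x _ => hstar x

end XYTorus

end Literature.MathematicalPhysics.QuantumLattice
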